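import Mathlib
import HarnessLib
import Literature.Computability.AlgebraicComplexity.NilCoxeterTensor
import Summits.MatrixMultiplication.MatrixMultiplication.Theses.NilCoxeterShadow
import Summits.MatrixMultiplication.MatrixMultiplication.Theorems.NilCoxeterShadowAThesisOfInductiveCosetGrowth
import Summits.MatrixMultiplication.MatrixMultiplication.Theorems.NilCoxeterShadowDegenerationTransfer
import Summits.MatrixMultiplication.MatrixMultiplication.Theorems.NilCoxeterShadowOmegaTwoGroupAlgebraRank

/-!
# `AThesis` (crux stmt-MatrixMultiplication-0956): false modulo TAME STEPS along the parabolic tower,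
# and false modulo the summit

Negative-side glue of line `birth`/`registered` (lead cycle 2), `sorry`-free; lands
`--supports stmt-MatrixMultiplication-0956`. Writing `b n := bR(T_{NC_n}) = algBorderRank (nilCoxeterTensor ℂ n)`:

* `AThesis_false_of_matrixMultiplication : MatrixMultiplication → ¬ AThesis` — the route's deciding theorem
  `closes` read contrapositively with its two LANDED supports (`degenerationTransfer_proof`,
  `omegaTwoGroupAlgebraRank_proof`): the kill criterion "any positive route proved" made explicit.
* `le_const_mul_factorial_rpow_of_tameSteps` — tame steps `b (n+1) ≤ (n+1)^(1+δ) · b n` from `n₁` on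
  accumulate to `b n ≤ K · (n!)^(1+δ)` (`K = b n₁ / (n₁!)^(1+δ)`), the mirror image of the accumulation lemma
  `exists_superpolynomial_of_growth` of the positive glue.
* `AThesis_false_of_tameSteps` — **TameSteps `⟹ ¬AThesis`**, where
  `TameSteps := ∀ δ > 0, ∀ᶠ n, b (n+1) ≤ (n+1)^(1+δ) · b n` (sub-polynomial excess of EVERY large step):
  at `δ = δ₀/2`, `(n!)^(1+δ₀) ≤ b n ≤ K (n!)^(1+δ₀/2)` infinitely often is absurd. TameSteps is implied by
  the strategist's `TameRecursion` (`∃ C, ∀ᶠ n, b (n+1) ≤ C (n+1) b n`, STRATEGY-CENSUS §Negation N1;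
  `tameSteps_of_tameRecursion`); it is the weakest STEP-WISE tameness hypothesis that kills the crux, hence
  the sharpest typed target of this shape for the crux's disprover. Its negation
  `¬TameSteps ⟺ ∃ δ > 0, b (n+1) > (n+1)^(1+δ) · b n for infinitely many n` (super-linear steps infinitely
  often) is strictly weaker than the line's stub `InductiveCosetGrowth` (super-linear steps at EVERY large
  `n`) and does NOT imply `AThesis` (sparse big steps do not accumulate).
* `InductiveCosetGrowth_false_of_tameSteps`, `AThesis_false_of_tameRecursion` — corollaries.
-/

-- `Summit.<Summit>.<Problem>`: for the single-conjunct summit the duplicate component is mandated.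
set_option linter.dupNamespace false

noncomputable section

namespace Summit.MatrixMultiplication.MatrixMultiplication.Theorems.AThesis.Negative

open Filter
open Literature.Computability.AlgebraicComplexity
open Summit.MatrixMultiplication.MatrixMultiplication.Theses.NilCoxeterShadow

/-- **The summit kills the crux**: `ω(ℂ) = 2 → ¬AThesis`, i.e. the route's `closes` with its two landed
support items, contrapositively. [folklore] -/
theorem AThesis_false_of_matrixMultiplication : _root_.MatrixMultiplication → ¬ AThesis :=
  fun hMM hA => closes hA Summit.MatrixMultiplication.MatrixMultiplication.Theorems.degenerationTransfer_proof
    Summit.MatrixMultiplication.MatrixMultiplication.Theorems.omegaTwoGroupAlgebraRank_proof hMM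

/-- **Accumulation of tame steps.** If `b (n+1) ≤ (n+1)^(1+δ) · b n` for all `n ≥ n₁`, then
`b n ≤ K · (n!)^(1+δ)` for all `n ≥ n₁`, with `K = b n₁ / (n₁!)^(1+δ)`. [folklore] -/
theorem le_const_mul_factorial_rpow_of_tameSteps (b : ℕ → ℝ) (δ : ℝ) (n₁ : ℕ)
    (hstep : ∀ n : ℕ, n₁ ≤ n → b (n + 1) ≤ ((n : ℝ) + 1) ^ (1 + δ) * b n) :
    ∀ n : ℕ, n₁ ≤ n → b n ≤ b n₁ / ((n₁.factorial : ℕ) : ℝ) ^ (1 + δ) * ((n.factorial : ℕ) : ℝ) ^ (1 + δ) := by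
  have hfpos : ∀ m : ℕ, (0 : ℝ) < ((m.factorial : ℕ) : ℝ) := fun m => by exact_mod_cast m.factorial_pos
  -- by induction on `k`, `n = n₁ + k`
  have hacc : ∀ k : ℕ, b (n₁ + k) ≤
      b n₁ / ((n₁.factorial : ℕ) : ℝ) ^ (1 + δ) * (((n₁ + k).factorial : ℕ) : ℝ) ^ (1 + δ) := by
    intro k
    induction k with
    | zero =>
      rw [Nat.add_zero, div_mul_cancel₀ _ (Real.rpow_pos_of_pos (hfpos n₁) _).ne']
    | succ k ih =>
      have hs := hstep (n₁ + k) (Nat.le_add_right _ _)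
      have hfac : (((n₁ + (k + 1)).factorial : ℕ) : ℝ) =
          (((n₁ + k : ℕ) : ℝ) + 1) * (((n₁ + k).factorial : ℕ) : ℝ) := by
        rw [← Nat.add_assoc, Nat.factorial_succ]
        push_cast
        ring
      have hpos1 : (0 : ℝ) ≤ ((n₁ + k : ℕ) : ℝ) + 1 := by positivity
      have hpow0 : (0 : ℝ) ≤ (((n₁ + k : ℕ) : ℝ) + 1) ^ (1 + δ) := Real.rpow_nonneg hpos1 _
      rw [hfac, Real.mul_rpow hpos1 (hfpos _).le]
      calc b (n₁ + (k + 1)) = b (n₁ + k + 1) := by rw [Nat.add_assoc]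
        _ ≤ (((n₁ + k : ℕ) : ℝ) + 1) ^ (1 + δ) * b (n₁ + k) := hs
        _ ≤ (((n₁ + k : ℕ) : ℝ) + 1) ^ (1 + δ) *
              (b n₁ / ((n₁.factorial : ℕ) : ℝ) ^ (1 + δ) * (((n₁ + k).factorial : ℕ) : ℝ) ^ (1 + δ)) :=
            mul_le_mul_of_nonneg_left ih hpow0
        _ = b n₁ / ((n₁.factorial : ℕ) : ℝ) ^ (1 + δ) *
              ((((n₁ + k : ℕ) : ℝ) + 1) ^ (1 + δ) * (((n₁ + k).factorial : ℕ) : ℝ) ^ (1 + δ)) := by ring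
  intro n hn
  obtain ⟨k, rfl⟩ := Nat.exists_eq_add_of_le hn
  exact hacc k

/-- **TameSteps `⟹ ¬AThesis`.** If for every `δ > 0` eventually `bR(T_{NC_{n+1}}) ≤ (n+1)^(1+δ) · bR(T_{NC_n})`,
then `AThesis` fails: with the crux's exponent `δ₀`, tame steps at `δ₀/2` give
`bR(T_{NC_n}) ≤ K (n!)^(1+δ₀/2)` for all large `n`, so `(n!)^(1+δ₀) ≤ bR(T_{NC_n})` infinitely often forces
`(n!)^(δ₀/2) ≤ K` infinitely often — absurd since `n! ≥ n`. [folklore] -/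
theorem AThesis_false_of_tameSteps
    (H : ∀ δ : ℝ, 0 < δ → ∀ᶠ n : ℕ in atTop,
      (algBorderRank (nilCoxeterTensor ℂ (n + 1)) : ℝ) ≤
        ((n : ℝ) + 1) ^ (1 + δ) * (algBorderRank (nilCoxeterTensor ℂ n) : ℝ)) :
    ¬ AThesis := by
  intro hA
  have hA' : ∃ δ : ℝ, 0 < δ ∧ ∀ n₀ : ℕ, ∃ n : ℕ, n₀ ≤ n ∧
      (n.factorial : ℝ) ^ (1 + δ) ≤ (algBorderRank (nilCoxeterTensor ℂ n) : ℝ) := hA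
  obtain ⟨δ₀, hδ₀, hio⟩ := hA'
  obtain ⟨n₁, hn₁⟩ := eventually_atTop.mp (H (δ₀ / 2) (half_pos hδ₀))
  have hbound := le_const_mul_factorial_rpow_of_tameSteps
    (fun n => (algBorderRank (nilCoxeterTensor ℂ n) : ℝ)) (δ₀ / 2) n₁ (fun n hn => hn₁ n hn)
  set K : ℝ := (algBorderRank (nilCoxeterTensor ℂ n₁) : ℝ) / ((n₁.factorial : ℕ) : ℝ) ^ (1 + δ₀ / 2)
    with hK
  -- `M = max K 1` is exceeded by `(n!)^(δ₀/2)` for `n ≥ N`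
  set M : ℝ := max K 1 with hM
  have hM0 : 0 < M := lt_of_lt_of_le one_pos (le_max_right _ _)
  obtain ⟨N, hN⟩ := exists_nat_gt (M ^ (1 / (δ₀ / 2)))
  obtain ⟨n, hNn, hn⟩ := hio (max N n₁)
  have hn₁n : n₁ ≤ n := le_trans (le_max_right _ _) hNn
  have hNn' : N ≤ n := le_trans (le_max_left _ _) hNn
  have hfpos : (0 : ℝ) < (n.factorial : ℝ) := by exact_mod_cast n.factorial_pos
  -- `(n!)^(1+δ₀) ≤ b n ≤ K (n!)^(1+δ₀/2)`
  have h1 : (n.factorial : ℝ) ^ (1 + δ₀) ≤ K * (n.factorial : ℝ) ^ (1 + δ₀ / 2) := by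
    have h := hbound n hn₁n
    beta_reduce at h
    exact hn.trans h
  have hsplit : (1 + δ₀) = δ₀ / 2 + (1 + δ₀ / 2) := by ring
  rw [hsplit, Real.rpow_add hfpos] at h1
  have h2 : (n.factorial : ℝ) ^ (δ₀ / 2) ≤ K := le_of_mul_le_mul_right h1 (Real.rpow_pos_of_pos hfpos _)
  have h3 : (n.factorial : ℝ) ^ (δ₀ / 2) ≤ M := h2.trans (le_max_left _ _)
  have h4 : M < (N : ℝ) ^ (δ₀ / 2) := by
    have hε1 : (1 / (δ₀ / 2)) * (δ₀ / 2) = 1 := by field_simp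
    have : (M ^ (1 / (δ₀ / 2))) ^ (δ₀ / 2) = M := by rw [← Real.rpow_mul hM0.le, hε1, Real.rpow_one]
    calc M = (M ^ (1 / (δ₀ / 2))) ^ (δ₀ / 2) := this.symm
      _ < (N : ℝ) ^ (δ₀ / 2) := Real.rpow_lt_rpow (Real.rpow_nonneg hM0.le _) hN (half_pos hδ₀)
  have h5 : (N : ℝ) ^ (δ₀ / 2) ≤ (n.factorial : ℝ) ^ (δ₀ / 2) := by
    refine Real.rpow_le_rpow (Nat.cast_nonneg _) ?_ (half_pos hδ₀).le
    exact_mod_cast hNn'.trans n.self_le_factorial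
  linarith

/-- **TameSteps `⟹ ¬InductiveCosetGrowth`** (through the landed glue `stmt-0958 ⟹ stmt-0956`). [folklore] -/
theorem InductiveCosetGrowth_false_of_tameSteps
    (H : ∀ δ : ℝ, 0 < δ → ∀ᶠ n : ℕ in atTop,
      (algBorderRank (nilCoxeterTensor ℂ (n + 1)) : ℝ) ≤
        ((n : ℝ) + 1) ^ (1 + δ) * (algBorderRank (nilCoxeterTensor ℂ n) : ℝ)) :
    ¬ InductiveCosetGrowth :=
  fun h => AThesis_false_of_tameSteps H (aThesis_of_inductiveCosetGrowth h)

/-- **TameRecursion `⟹` TameSteps**: a linear-overhead step `b (n+1) ≤ C (n+1) b n` is eventually below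
`(n+1)^(1+δ) · b n` for every `δ > 0` (as soon as `(n+1)^δ ≥ C`). [folklore] -/
theorem tameSteps_of_tameRecursion
    (H : ∃ C : ℝ, ∀ᶠ n : ℕ in atTop,
      (algBorderRank (nilCoxeterTensor ℂ (n + 1)) : ℝ) ≤
        C * ((n : ℝ) + 1) * (algBorderRank (nilCoxeterTensor ℂ n) : ℝ)) :
    ∀ δ : ℝ, 0 < δ → ∀ᶠ n : ℕ in atTop,
      (algBorderRank (nilCoxeterTensor ℂ (n + 1)) : ℝ) ≤
        ((n : ℝ) + 1) ^ (1 + δ) * (algBorderRank (nilCoxeterTensor ℂ n) : ℝ) := by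
  intro δ hδ
  obtain ⟨C, hC⟩ := H
  -- eventually `C ≤ (n+1)^δ`
  have hev : ∀ᶠ n : ℕ in atTop, C ≤ ((n : ℝ) + 1) ^ δ := by
    have hM0 : 0 < max C 1 := lt_of_lt_of_le one_pos (le_max_right _ _)
    obtain ⟨N, hN⟩ := exists_nat_ge ((max C 1) ^ (1 / δ))
    refine eventually_atTop.mpr ⟨N, fun n hn => ?_⟩
    have hδ1 : (1 / δ) * δ = 1 := by field_simp
    have h1 : ((max C 1) ^ (1 / δ)) ^ δ = max C 1 := by rw [← Real.rpow_mul hM0.le, hδ1, Real.rpow_one]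
    have h2 : ((max C 1) ^ (1 / δ)) ^ δ ≤ ((n : ℝ) + 1) ^ δ := by
      refine Real.rpow_le_rpow (Real.rpow_nonneg hM0.le _) ?_ hδ.le
      calc (max C 1) ^ (1 / δ) ≤ N := hN
        _ ≤ (n : ℝ) := by exact_mod_cast hn
        _ ≤ (n : ℝ) + 1 := by linarith
    rw [h1] at h2
    exact (le_max_left C 1).trans h2
  filter_upwards [hC, hev] with n h1 h2
  have hb : (0 : ℝ) ≤ (algBorderRank (nilCoxeterTensor ℂ n) : ℝ) := Nat.cast_nonneg _
  have hn1 : (0 : ℝ) < (n : ℝ) + 1 := by positivity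
  calc (algBorderRank (nilCoxeterTensor ℂ (n + 1)) : ℝ)
      ≤ C * ((n : ℝ) + 1) * (algBorderRank (nilCoxeterTensor ℂ n) : ℝ) := h1
    _ ≤ ((n : ℝ) + 1) ^ δ * ((n : ℝ) + 1) * (algBorderRank (nilCoxeterTensor ℂ n) : ℝ) :=
        mul_le_mul_of_nonneg_right (mul_le_mul_of_nonneg_right h2 hn1.le) hb
    _ = ((n : ℝ) + 1) ^ (1 + δ) * (algBorderRank (nilCoxeterTensor ℂ n) : ℝ) := by
        rw [add_comm 1 δ, Real.rpow_add hn1, Real.rpow_one]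

/-- **TameRecursion `⟹ ¬AThesis`** (STRATEGY-CENSUS §Negation N1, made kernel-checked):
`(∃ C, ∀ᶠ n, bR(T_{NC_{n+1}}) ≤ C (n+1) bR(T_{NC_n})) → ¬AThesis`. [folklore] -/
theorem AThesis_false_of_tameRecursion
    (H : ∃ C : ℝ, ∀ᶠ n : ℕ in atTop,
      (algBorderRank (nilCoxeterTensor ℂ (n + 1)) : ℝ) ≤
        C * ((n : ℝ) + 1) * (algBorderRank (nilCoxeterTensor ℂ n) : ℝ)) :
    ¬ AThesis :=
  AThesis_false_of_tameSteps (tameSteps_of_tameRecursion H)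

end Summit.MatrixMultiplication.MatrixMultiplication.Theorems.AThesis.Negative

end
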